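import Mathlib
import Literature.NumberTheory.LFunctions.Zhang2022.SkeletonPartTwo
import Literature.NumberTheory.LFunctions.Zhang2022.Section8ChangeOfVariables
import HarnessLib

/-!
# Zhang (2022) §8, typed statements (d): the main-term constants of `Ξ₁₁` —
# `𝔣_{jμ}(Pᶻ) = 𝔣𝔣_{jμ}(z) + O(𝓛⁻⁸)`, (8.13)–(8.18), the four `x = Pᶻ` substitutions,
# "Inserting these into (8.13)", (8.19)–(8.22), `Θ₁(𝐚₁₁,𝐚₂₁)`, (8.23), `𝔠₁`, the printed
# numerical values of `c₁₁, c₂₂, c₁₂`, and (8.24)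

Topic `Literature/NumberTheory/LFunctions/Zhang2022` (Landau–Siegel audit tree; verdict-neutral).
D-0069 campaign, layer L2, slice **L2-t9** (`plan/L2/ASSIGNMENTS.md` v1 §B row 9): Y. Zhang,
*Discrete mean estimates and the Landau–Siegel zero*, arXiv:2211.02515v1 (2022)
[Zhang2022LandauSiegel], §8 "Evaluation of `Ξ₁₁`", closing part: tex L2479–L2584 of the arXiv
source `lsz3__2_.tex`, PDF pp. 48–50. **An unrefereed manuscript under adjudication: every
`def … : Prop` below is a CLAIM OF THE MANUSCRIPT (or the manuscript's own DEFINITION, recorded as an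
identity about the tree's already-banked transcription), STATED NOT ASSERTED.** Statement-only;
typed ≠ discharged. The handful of `theorem`s are definitional unfoldings (`rfl`/`ring`) recording
that the banked objects of `Section8Defs` ARE the printed displays, read again on the page.

This slice is the stretch of §8 between (8.12) and (8.24): the passage from the `x`-integrals of
(8.12) to the `z`-integrals `b₁₁, b₂₂, b₂₁, b₁₂` and the constant `𝔠₁` of (8.23), ending with the
printed numerical values and the printed inequality (8.24). Every step is typed OVER THE SKELETON'S
OBJECTS — the true shifts `β_j = β_j(c′)` of (2.13) (`Skeleton.betaJ`), `β₆, β₇` (`Skeleton.betaMu`),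
`𝔣_{jμ}`, `𝔤_{jμ}` (`Skeleton.frakfW`, `Skeleton.frakgW`), `P, P₁, P₂, T, α, 𝓛`
(`Skeleton.bigP/P1/P2/bigT/alpha/ell`), `S_j` (`Skeleton.Sj`), `Θ₁` (`Skeleton.Theta1`), `𝐚₁₁, 𝐚₂₁`
(`Skeleton.a11/a21`), `𝔞` (`Skeleton.frakA`), `𝔓` (`frakP`) — so that each claim carries the
manuscript's `D`-dependence and its `O(𝓛⁻⁸)` / `o(α)` / `o(1)` / `o(𝔓)` error exactly as printed,
with the conventions of `skel/INTERFACE.md` §3 (`Skeleton.ForAllLarge`, `Skeleton.AssumptionA`).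
The printed closed forms `𝔣𝔣_{jμ}, 𝔤𝔥_{jμ}` ((8.13)–(8.18)), `b₁₁, b₂₂, b₂₁, b₁₂` ((8.19)–(8.22)),
`c₁₁, c₂₂, c₁₂, c₂₁`, `ι₂` ((2.26)), `𝔠₁` ((8.23)) and the inequality (8.24) (`Ineq824`) are BANKED
in `Section8Defs` (namespace `…Zhang2022`; referee stamp `DEFINITION FROZEN Section8Defs.lean
d7ac564585216fac`, 2026-08-25) and are CITED here, never re-declared; the MAIN-ORDER versions of
the steps below are kernel theorems of `Section8MainTerms` (`frakf_main_*`, `frakg_main_*`),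
`Section8ChangeOfVariables` (`display818_diag`, `display818_cross₁`, `display818_cross₂`,
`S812_eq_zform`, `weighted_sum_S811_main`, `Theta1Coeff`, `frakc1_eq_coeff_add_conj`) and
`Section8Certificate` (`c11_re_bounds`, `c22_re_bounds`, `c12_re_bounds`, `c12_im_bounds`,
`frakc1_re_bounds`, `not_ineq824`, `ineq824_of_printed_constants`) — each docstring below says
which.

| DAG node | locator | decl(s) here | content (as printed) | banked / tree status |
|---|---|---|---|---|
| `Z22:§8.u049` | p.48, tex L2480 | `Step8u049 c′` | `𝔣_{j6}(Pᶻ) = 𝔣𝔣_{j6}(z) + O(𝓛⁻⁸)`, `𝔤_{j6}(Pᶻ) = 𝔤𝔥_{j6}(z) + O(𝓛⁻⁸)` (`0 ≤ z ≤ 1`) | main order `frakf_main_j6`, `frakg_main_j6` |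
| `Z22:§8.u050` | p.49, tex L2483 | `Step8u050 c′` | same with `μ = 7` | `frakf_main_j7`, `frakg_main_j7` |
| `Z22:(8.13)`–`Z22:(8.18)` | p.49, tex L2487–L2504 | `Eq813` … `Eq818` (+ `_holds`) | the twelve closed forms `𝔣𝔣_{jμ}, 𝔤𝔥_{jμ}` | `ff16 … gh37` (`Section8Defs`) |
| `Z22:§8.u051`–`Z22:§8.u054` | p.49, tex L2506–L2521 | `Step8u051 c′` … `Step8u054 c′` | the four "Substituting `x = Pᶻ`" displays, `+ o(α)` | main order `display818_diag/cross₁/cross₂` |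
| `Z22:§8.u055` | p.49, tex L2523 | `Step8u055 c′` | `(2α)⁻¹S₁ + 2α⁻¹S₂ + (3/2)α⁻¹S₃ = 𝔞(b₁₁ + ι₂b₂₁ + ῑ₂b₁₂ + |ι₂|²b₂₂) + o(1)` | main order `weighted_sum_S811_main` |
| `Z22:(8.19)`–`Z22:(8.22)` | pp.49–50, tex L2528–L2544 | `Eq819` … `Eq822` (+ `_holds`) | the four integrals `b₁₁, b₂₂, b₂₁, b₁₂` | `b11, b22, b21, b12` (`Section8Defs`) |
| `Z22:§8.u056` | p.50, tex L2546 | `Step8u056 c′`, `DedStep8u056 c′` | `Θ₁(𝐚₁₁,𝐚₂₁) = (b₁₁ + ι₂b₂₁ + ῑ₂b₁₂ + |ι₂|²b₂₂)𝔞𝔓 + o(𝔓)` ("by Proposition 7.1") | `Theta1Coeff`; refines `Skeleton.Ded823` |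
| `Z22:(8.23)` | p.50, tex L2550 | (banked) `Skeleton.Eval823 c′`; `DedEval823 c′` (+ `_holds`) | `Ξ₁₁ = 𝔠₁𝔞𝔓 + o(𝔓)` ("by (8.7)") | `Skeleton.Eval823/Ded823/eval823_of`, `frakc1_eq_coeff_add_conj` |
| `Z22:§8.u057`–`Z22:§8.u061` | p.50, tex L2554–L2568 | `Step8u057` … `Step8u061` (+ `_holds`) | `𝔠₁ = c₁₁ + ι₂c₂₁ + ῑ₂c₁₂ + |ι₂|²c₂₂`, `c₁₁ = b₁₁ + b̄₁₁`, `c₂₂ = b₂₂ + b̄₂₂`, `c₁₂ = b₁₂ + b̄₂₁`, `c₂₁ = c̄₁₂` | `frakc1, c11, c22, c12, c21` (`Section8Defs`) |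
| `Z22:§8.u062`–`Z22:§8.u064` | p.50, tex L2572–L2580 | `Step8u062_num`, `Step8u063_num`, `Step8u064_num` | "`c₁₁ = 3.61226 + ε/2`", "`c₂₂ = 1.32215 + ε/2`", "`c₁₂ = −0.45757 − 0.18179i + ε/√2`" (`|ε| < 10⁻⁵`) | num lane; tree: `c11_re_bounds`, `c22_re_bounds` (consistent), `c12_re_bounds`, `c12_im_bounds` (inconsistent) |
| `Z22:(8.24)` | p.50, tex L2582 | (banked) `Ineq824` — nothing new declared | "It follows that `𝔠₁ < 6.9955`" | REFUTED in tree: `not_ineq824` (`𝔠₁ = 7.0501…`); digit arithmetic `ineq824_of_printed_constants` |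

Conventions (skel/INTERFACE.md §3, binding): "`X = M + O(𝓛⁻⁸)`" ↦ `∃ C, ForAllLarge (‖X − M‖ ≤ C·𝓛⁻⁸)`;
"`X = M + o(α)`" ↦ `∀ ε > 0, ForAllLarge (‖X − M‖ ≤ ε·α)`; "`+ o(1)`" ↦ `≤ ε`; "`+ o(𝔓)`" ↦ `≤ ε·𝔓`;
Assumption (A) as an antecedent wherever `χ`-dependent objects (`S_j`, `Θ₁`, `𝔞`) enter (§5: "we
henceforth assume that (A) holds"); `j` ranges over `{1, 2, 3}` ("We continue to assume `1 ≤ j ≤ 3`");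
`|ι₂|²` is `Complex.normSq ι₂` (as in the banked `frakc1`); the manuscript's rounding `ε` ("a complex
number satisfying `|ε| < 10⁻⁵`, not necessarily the same in each occurrence", p. 50) is an
existentially quantified `e : ℂ` per display. The printed profiles are dispatched by
`ffP j μ`, `ghP j μ` (`(j, μ) ↦ 𝔣𝔣_{jμ}, 𝔤𝔥_{jμ}`, `j` read modulo `3` and `μ ≠ 7 ↦ 6`, the index
conventions of `Skeleton.betaJ`, `Skeleton.betaMu`).

AMBIGUITIES flagged (typed by the most literal reading; see the docstrings): (i) p. 49 "Inserting
these into (8.13)" — the four substitution displays are inserted into **(8.12)** (tex L2472–L2478),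
(8.13) being a definition; the typed claim `Step8u055` does not depend on the label. (ii) The fourth
substitution display prints "`𝔤_{j7}(x))`" with a stray parenthesis (tex L2518). (iii) The error terms
of the four displayed applications of Lemmas 8.2/8.4 on p. 47 (`O(𝓛⁻¹⁵)` vs the lemmas' `O(𝓛⁻⁶)`) are
slice L2-t8's, not restated here.

WHAT THIS FILE IS NOT: a proof or refutation of anything beyond definitional unfoldings; in
particular it does not assert (8.23), the numerical values, or (8.24) (whose refutation
`not_ineq824` is the tree's, cited not re-derived), and it makes no claim about the manuscript's
Theorems 1–2 or about Landau–Siegel zeros. Interfaces consumed: `Skeleton.*` (SkeletonSetting,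
SkeletonObjects, SkeletonMeanValue, SkeletonPartTwo), `Section8Defs`, `Section8ChangeOfVariables`;
interfaces provided: the `Step8u0NN`/`Eq8NN` claims for the dischargers of `Skeleton.Ded823`, in the
chain `(8.12) [L2-t8] + Step8u049–Step8u054 ⇒ Step8u055 ⇒ (Prop. 7.1) Step8u056 ⇒ ((8.7)) (8.23)`.

## References

* Y. Zhang, *Discrete mean estimates and the Landau–Siegel zero*, arXiv:2211.02515v1 (2022), §8
  pp. 48–50, displays (8.12)–(8.24); §2 (2.13), (2.21), (2.22), (2.26), (2.31); §7 Prop. 7.1.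
  [cite: Zhang2022LandauSiegel, §8 pp. 48–50]
-/

noncomputable section

open Complex Real ComplexConjugate

namespace Literature.NumberTheory.LFunctions.Zhang2022.Section8dStatements

/-! ## The printed profiles `𝔣𝔣_{jμ}`, `𝔤𝔥_{jμ}` as functions of the indices -/

/-- `Z22:(8.13)`–`Z22:(8.18)` OBJECT (dispatcher, no new content): the printed profile `𝔣𝔣_{jμ}`
of (8.13)–(8.18) as a function of `(j, μ)`, `j` read modulo `3` (the convention `β₄ = β₁, β₅ = β₂`
of §8 p. 45, as in `Skeleton.betaJ`) and `μ ≠ 7 ↦ 6` (as in `Skeleton.betaMu`); values are the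
banked `ff16, ff26, ff36, ff17, ff27, ff37` of `Section8Defs`.
[cite: Zhang2022LandauSiegel, §8 (8.13)–(8.18) p.49] -/
def ffP (j μ : ℕ) : ℝ → ℂ :=
  if μ = 7 then (if j % 3 = 1 then ff17 else if j % 3 = 2 then ff27 else ff37)
  else (if j % 3 = 1 then ff16 else if j % 3 = 2 then ff26 else ff36)

/-- `Z22:(8.13)`–`Z22:(8.18)` OBJECT (dispatcher): the printed profile `𝔤𝔥_{jμ}` of (8.13)–(8.18)
as a function of `(j, μ)` (same index conventions as `ffP`); values `gh16, gh26, gh36, gh17, gh27,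
gh37` of `Section8Defs`. [cite: Zhang2022LandauSiegel, §8 (8.13)–(8.18) p.49] -/
def ghP (j μ : ℕ) : ℝ → ℂ :=
  if μ = 7 then (if j % 3 = 1 then gh17 else if j % 3 = 2 then gh27 else gh37)
  else (if j % 3 = 1 then gh16 else if j % 3 = 2 then gh26 else gh36)

/-- `ffP 1 6 = 𝔣𝔣₁₆`. [cite: Zhang2022LandauSiegel, §8 (8.13) p.49] -/
theorem ffP_one_six : ffP 1 6 = ff16 := by simp [ffP]
/-- `ffP 2 6 = 𝔣𝔣₂₆`. [cite: Zhang2022LandauSiegel, §8 (8.14) p.49] -/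
theorem ffP_two_six : ffP 2 6 = ff26 := by simp [ffP]
/-- `ffP 3 6 = 𝔣𝔣₃₆`. [cite: Zhang2022LandauSiegel, §8 (8.15) p.49] -/
theorem ffP_three_six : ffP 3 6 = ff36 := by simp [ffP]
/-- `ffP 1 7 = 𝔣𝔣₁₇`. [cite: Zhang2022LandauSiegel, §8 (8.16) p.49] -/
theorem ffP_one_seven : ffP 1 7 = ff17 := by simp [ffP]
/-- `ffP 2 7 = 𝔣𝔣₂₇`. [cite: Zhang2022LandauSiegel, §8 (8.17) p.49] -/
theorem ffP_two_seven : ffP 2 7 = ff27 := by simp [ffP]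
/-- `ffP 3 7 = 𝔣𝔣₃₇`. [cite: Zhang2022LandauSiegel, §8 (8.18) p.49] -/
theorem ffP_three_seven : ffP 3 7 = ff37 := by simp [ffP]
/-- `ghP 1 6 = 𝔤𝔥₁₆`. [cite: Zhang2022LandauSiegel, §8 (8.13) p.49] -/
theorem ghP_one_six : ghP 1 6 = gh16 := by simp [ghP]
/-- `ghP 2 6 = 𝔤𝔥₂₆`. [cite: Zhang2022LandauSiegel, §8 (8.14) p.49] -/
theorem ghP_two_six : ghP 2 6 = gh26 := by simp [ghP]
/-- `ghP 3 6 = 𝔤𝔥₃₆`. [cite: Zhang2022LandauSiegel, §8 (8.15) p.49] -/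
theorem ghP_three_six : ghP 3 6 = gh36 := by simp [ghP]
/-- `ghP 1 7 = 𝔤𝔥₁₇`. [cite: Zhang2022LandauSiegel, §8 (8.16) p.49] -/
theorem ghP_one_seven : ghP 1 7 = gh17 := by simp [ghP]
/-- `ghP 2 7 = 𝔤𝔥₂₇`. [cite: Zhang2022LandauSiegel, §8 (8.17) p.49] -/
theorem ghP_two_seven : ghP 2 7 = gh27 := by simp [ghP]
/-- `ghP 3 7 = 𝔤𝔥₃₇`. [cite: Zhang2022LandauSiegel, §8 (8.18) p.49] -/
theorem ghP_three_seven : ghP 3 7 = gh37 := by simp [ghP]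

/-! ## `𝔣_{jμ}(Pᶻ) = 𝔣𝔣_{jμ}(z) + O(𝓛⁻⁸)` (pp. 48–49) -/

section Claims

variable (c' : ℝ)

/-- `Z22:§8.u049` CLAIM (p. 48 last line, tex L2480): "By direct calculation, for `0 ≤ z ≤ 1` we
have `𝔣_{j6}(Pᶻ) = 𝔣𝔣_{j6}(z) + O(𝓛⁻⁸)`, `𝔤_{j6}(Pᶻ) = 𝔤𝔥_{j6}(z) + O(𝓛⁻⁸)`" — for the TRUE shifts
`β_j = β_j(c′)` of (2.13) (`Skeleton.frakfW/frakgW`, `1 ≤ j ≤ 3`), uniformly in `0 ≤ z ≤ 1`, `D`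
large (the implied constant may depend on `c′`). At the MAIN VALUES `β_j⁰ = jiα` the identities hold
EXACTLY: tree `frakf_main_16/26/36`, `frakg_main_16/26/36` (`Section8MainTerms`); the `O(𝓛⁻⁸)` is
`β_j − β_j⁰ = O(c′α²𝓛)` times `log P`, `α𝓛 = π𝓛⁻⁸`. Refines `Skeleton.Ded823` (step (8.12)→(8.19)).
[cite: Zhang2022LandauSiegel, §8 p.48, tex L2480] -/
def Step8u049 : Prop :=
  ∃ C : ℝ, Skeleton.ForAllLarge fun D _ _ => ∀ j ∈ ({1, 2, 3} : Finset ℕ), ∀ z : ℝ, 0 ≤ z → z ≤ 1 →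
    ‖Skeleton.frakfW c' D j 6 (Skeleton.bigP D ^ z) - ffP j 6 z‖ ≤ C * (Skeleton.ell D ^ 8)⁻¹ ∧
      ‖Skeleton.frakgW c' D j 6 (Skeleton.bigP D ^ z) - ghP j 6 z‖ ≤ C * (Skeleton.ell D ^ 8)⁻¹

/-- `Z22:§8.u050` CLAIM (p. 49 first line, tex L2483): "`𝔣_{j7}(Pᶻ) = 𝔣𝔣_{j7}(z) + O(𝓛⁻⁸)`,
`𝔤_{j7}(Pᶻ) = 𝔤𝔥_{j7}(z) + O(𝓛⁻⁸)`" (`0 ≤ z ≤ 1`, `1 ≤ j ≤ 3`, `β₇ = 5iα/2`). Main values exact: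
tree `frakf_main_17/27/37`, `frakg_main_17/27/37`. Refines `Skeleton.Ded823`.
[cite: Zhang2022LandauSiegel, §8 p.49, tex L2483] -/
def Step8u050 : Prop :=
  ∃ C : ℝ, Skeleton.ForAllLarge fun D _ _ => ∀ j ∈ ({1, 2, 3} : Finset ℕ), ∀ z : ℝ, 0 ≤ z → z ≤ 1 →
    ‖Skeleton.frakfW c' D j 7 (Skeleton.bigP D ^ z) - ffP j 7 z‖ ≤ C * (Skeleton.ell D ^ 8)⁻¹ ∧
      ‖Skeleton.frakgW c' D j 7 (Skeleton.bigP D ^ z) - ghP j 7 z‖ ≤ C * (Skeleton.ell D ^ 8)⁻¹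

end Claims

/-! ## (8.13)–(8.18): the printed closed forms, as identities about the banked `ff16 … gh37` -/

/-- `Z22:(8.13)` DEFINITION (p. 49, tex L2487; banked: `ff16 = ffF (1/2) (3/2)`,
`gh16 = ghF (8/3) (-5/3) (-1/2) (3/2)`, `Section8Defs`): "`𝔣𝔣₁₆(z) = (1 + (πi/2)z)e^{(3πi/2)z}`,
`𝔤𝔥₁₆(z) = 8/3 + (−5/3 − (πi/2)z)e^{(−3πi/2)z}`" — recorded as the statement that the banked
generic-shape definitions ARE these printed closed forms (read on the page). [cite: Zhang2022LandauSiegel, §8 (8.13) p.49, tex L2487] -/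
def Eq813 : Prop := ∀ z : ℝ,
  ff16 z = (1 + π * I / 2 * z) * cexp (3 * π * I / 2 * z) ∧
    gh16 z = 8 / 3 + (-5 / 3 - π * I / 2 * z) * cexp (-3 * π * I / 2 * z)

/-- `Z22:(8.14)` DEFINITION (p. 49, tex L2490; banked `ff26`, `gh26`): "`𝔣𝔣₂₆(z) = (1 − (πi/2)z)e^{(3πi/2)z}`,
`𝔤𝔥₂₆(z) = 4/3 + (−1/3 + (πi/2)z)e^{(−3πi/2)z}`". [cite: Zhang2022LandauSiegel, §8 (8.14) p.49, tex L2490] -/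
def Eq814 : Prop := ∀ z : ℝ,
  ff26 z = (1 - π * I / 2 * z) * cexp (3 * π * I / 2 * z) ∧
    gh26 z = 4 / 3 + (-1 / 3 + π * I / 2 * z) * cexp (-3 * π * I / 2 * z)

/-- `Z22:(8.15)` DEFINITION (p. 49, tex L2493; banked `ff36`, `gh36`): "`𝔣𝔣₃₆(z) = (1 − (3πi/2)z)e^{(3πi/2)z}`,
`𝔤𝔥₃₆(z) = 8/9 + (1/9 + (πi/6)z)e^{(−3πi/2)z}`". [cite: Zhang2022LandauSiegel, §8 (8.15) p.49, tex L2493] -/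
def Eq815 : Prop := ∀ z : ℝ,
  ff36 z = (1 - 3 * π * I / 2 * z) * cexp (3 * π * I / 2 * z) ∧
    gh36 z = 8 / 9 + (1 / 9 + π * I / 6 * z) * cexp (-3 * π * I / 2 * z)

/-- `Z22:(8.16)` DEFINITION (p. 49, tex L2496; banked `ff17`, `gh17`): "`𝔣𝔣₁₇(z) = (1 + (3πi/2)z)e^{(5πi/2)z}`,
`𝔤𝔥₁₇(z) = 24/25 + (1/25 + (πi/10)z)e^{(−5πi/2)z}`". [cite: Zhang2022LandauSiegel, §8 (8.16) p.49, tex L2496] -/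
def Eq816 : Prop := ∀ z : ℝ,
  ff17 z = (1 + 3 * π * I / 2 * z) * cexp (5 * π * I / 2 * z) ∧
    gh17 z = 24 / 25 + (1 / 25 + π * I / 10 * z) * cexp (-5 * π * I / 2 * z)

/-- `Z22:(8.17)` DEFINITION (p. 49, tex L2499; banked `ff27`, `gh27`): "`𝔣𝔣₂₇(z) = (1 + (πi/2)z)e^{(5πi/2)z}`,
`𝔤𝔥₂₇(z) = 12/25 + (13/25 + (3πi/10)z)e^{(−5πi/2)z}`". [cite: Zhang2022LandauSiegel, §8 (8.17) p.49, tex L2499] -/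
def Eq817 : Prop := ∀ z : ℝ,
  ff27 z = (1 + π * I / 2 * z) * cexp (5 * π * I / 2 * z) ∧
    gh27 z = 12 / 25 + (13 / 25 + 3 * π * I / 10 * z) * cexp (-5 * π * I / 2 * z)

/-- `Z22:(8.18)` DEFINITION (p. 49, tex L2502; banked `ff37`, `gh37`): "`𝔣𝔣₃₇(z) = (1 − (πi/2)z)e^{(5πi/2)z}`,
`𝔤𝔥₃₇(z) = 8/25 + (17/25 − (3πi/10)z)e^{(−5πi/2)z}`". [cite: Zhang2022LandauSiegel, §8 (8.18) p.49, tex L2502] -/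
def Eq818 : Prop := ∀ z : ℝ,
  ff37 z = (1 - π * I / 2 * z) * cexp (5 * π * I / 2 * z) ∧
    gh37 z = 8 / 25 + (17 / 25 - 3 * π * I / 10 * z) * cexp (-5 * π * I / 2 * z)

/-- (8.13) holds for the banked `ff16`, `gh16` (definitional unfolding). [cite: Zhang2022LandauSiegel, §8 (8.13) p.49] -/
theorem eq813_holds : Eq813 := by
  intro z
  refine ⟨?_, ?_⟩
  · simp only [ff16, ffF]; push_cast; ring_nf
  · simp only [gh16, ghF]; push_cast; ring_nf

/-- `Eq813` — `_holds` alias of `eq813_holds` above under the fact's exact name (appended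
2026-08-28, D-0026 bookkeeping: the proof term is the existing theorem of this file; no statement,
definition or attribute is edited; no new named fact; the ledger's debt table listed the fact
unproved). [cite: Zhang2022LandauSiegel, §8 (8.13) p.49] -/
theorem _root_.Literature.NumberTheory.LFunctions.Zhang2022.Section8dStatements.Eq813_holds :
    Eq813 :=
  _root_.Literature.NumberTheory.LFunctions.Zhang2022.Section8dStatements.eq813_holds

/-- (8.14) holds for the banked `ff26`, `gh26`. [cite: Zhang2022LandauSiegel, §8 (8.14) p.49] -/
theorem eq814_holds : Eq814 := by
  intro z
  refine ⟨?_, ?_⟩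
  · simp only [ff26, ffF]; push_cast; ring_nf
  · simp only [gh26, ghF]; push_cast; ring_nf

/-- `Eq814` — `_holds` alias of `eq814_holds` above under the fact's exact name (appended
2026-08-28, D-0026 bookkeeping: the proof term is the existing theorem of this file; no statement,
definition or attribute is edited; no new named fact; the ledger's debt table listed the fact
unproved). [cite: Zhang2022LandauSiegel, §8 (8.14) p.49] -/
theorem _root_.Literature.NumberTheory.LFunctions.Zhang2022.Section8dStatements.Eq814_holds :
    Eq814 :=
  _root_.Literature.NumberTheory.LFunctions.Zhang2022.Section8dStatements.eq814_holds

/-- (8.15) holds for the banked `ff36`, `gh36`. [cite: Zhang2022LandauSiegel, §8 (8.15) p.49] -/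
theorem eq815_holds : Eq815 := by
  intro z
  refine ⟨?_, ?_⟩
  · simp only [ff36, ffF]; push_cast; ring_nf
  · simp only [gh36, ghF]; push_cast; ring_nf

/-- `Eq815` — `_holds` alias of `eq815_holds` above under the fact's exact name (appended
2026-08-28, D-0026 bookkeeping: the proof term is the existing theorem of this file; no statement,
definition or attribute is edited; no new named fact; the ledger's debt table listed the fact
unproved). [cite: Zhang2022LandauSiegel, §8 (8.15) p.49] -/
theorem _root_.Literature.NumberTheory.LFunctions.Zhang2022.Section8dStatements.Eq815_holds :
    Eq815 :=
  _root_.Literature.NumberTheory.LFunctions.Zhang2022.Section8dStatements.eq815_holds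

/-- (8.16) holds for the banked `ff17`, `gh17`. [cite: Zhang2022LandauSiegel, §8 (8.16) p.49] -/
theorem eq816_holds : Eq816 := by
  intro z
  refine ⟨?_, ?_⟩
  · simp only [ff17, ffF]; push_cast; ring_nf
  · simp only [gh17, ghF]; push_cast; ring_nf

/-- `Eq816` — `_holds` alias of `eq816_holds` above under the fact's exact name (appended
2026-08-28, D-0026 bookkeeping: the proof term is the existing theorem of this file; no statement,
definition or attribute is edited; no new named fact; the ledger's debt table listed the fact
unproved). [cite: Zhang2022LandauSiegel, §8 (8.16) p.49] -/
theorem _root_.Literature.NumberTheory.LFunctions.Zhang2022.Section8dStatements.Eq816_holds :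
    Eq816 :=
  _root_.Literature.NumberTheory.LFunctions.Zhang2022.Section8dStatements.eq816_holds

/-- (8.17) holds for the banked `ff27`, `gh27`. [cite: Zhang2022LandauSiegel, §8 (8.17) p.49] -/
theorem eq817_holds : Eq817 := by
  intro z
  refine ⟨?_, ?_⟩
  · simp only [ff27, ffF]; push_cast; ring_nf
  · simp only [gh27, ghF]; push_cast; ring_nf

/-- `Eq817` — `_holds` alias of `eq817_holds` above under the fact's exact name (appended
2026-08-28, D-0026 bookkeeping: the proof term is the existing theorem of this file; no statement,
definition or attribute is edited; no new named fact; the ledger's debt table listed the fact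
unproved). [cite: Zhang2022LandauSiegel, §8 (8.17) p.49] -/
theorem _root_.Literature.NumberTheory.LFunctions.Zhang2022.Section8dStatements.Eq817_holds :
    Eq817 :=
  _root_.Literature.NumberTheory.LFunctions.Zhang2022.Section8dStatements.eq817_holds

/-- (8.18) holds for the banked `ff37`, `gh37`. [cite: Zhang2022LandauSiegel, §8 (8.18) p.49] -/
theorem eq818_holds : Eq818 := by
  intro z
  refine ⟨?_, ?_⟩
  · simp only [ff37, ffF]; push_cast; ring_nf
  · simp only [gh37, ghF]; push_cast; ring_nf

/-- `Eq818` — `_holds` alias of `eq818_holds` above under the fact's exact name (appended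
2026-08-28, D-0026 bookkeeping: the proof term is the existing theorem of this file; no statement,
definition or attribute is edited; no new named fact; the ledger's debt table listed the fact
unproved). [cite: Zhang2022LandauSiegel, §8 (8.18) p.49] -/
theorem _root_.Literature.NumberTheory.LFunctions.Zhang2022.Section8dStatements.Eq818_holds :
    Eq818 :=
  _root_.Literature.NumberTheory.LFunctions.Zhang2022.Section8dStatements.eq818_holds

/-! ## "Substituting `x = Pᶻ` we obtain": the four displays after (8.18) (p. 49) -/

section Claims

variable (c' : ℝ)

/-- `Z22:§8.u051` CLAIM (p. 49, tex L2506), first display after (8.18): for `1 ≤ j ≤ 3`,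
"`(log P₁)⁻² ∫₁^{P₁} 𝔣_{j6}(x)𝔤_{j6}(x) dx/x = ((0.504)² log P)⁻¹ ∫₀^{0.504} 𝔣𝔣_{j6}(z)𝔤𝔥_{j6}(z) dz + o(α)`"
(`P₁ = P^{0.504}` (2.21), `log P = 𝓛⁹`). PROVED in the tree AT MAIN ORDER (shifts at `β_j⁰`, so no
`o(α)`): `display818_diag` with `θ = 0.504` (`Section8ChangeOfVariables`). Refines `Skeleton.Ded823`.
[cite: Zhang2022LandauSiegel, §8 p.49, tex L2506] -/
def Step8u051 : Prop :=
  ∀ ε : ℝ, 0 < ε → Skeleton.ForAllLarge fun D _ _ => ∀ j ∈ ({1, 2, 3} : Finset ℕ),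
    ‖1 / (Real.log (Skeleton.P1 D) : ℂ) ^ 2 *
          (∫ x in (1 : ℝ)..Skeleton.P1 D,
            Skeleton.frakfW c' D j 6 x * Skeleton.frakgW c' D j 6 x / x) -
        ((1 / (0.504 ^ 2 * Real.log (Skeleton.bigP D)) : ℝ) : ℂ) *
          ∫ z in (0 : ℝ)..0.504, ffP j 6 z * ghP j 6 z‖ ≤ ε * Skeleton.alpha D

/-- `Z22:§8.u052` CLAIM (p. 49, tex L2509), second display after (8.18): for `1 ≤ j ≤ 3`,
"`(log P₂)⁻² ∫₁^{P₂} 𝔣_{j7}(x)𝔤_{j7}(x) dx/x = ((0.5)² log P)⁻¹ ∫₀^{0.5} 𝔣𝔣_{j7}(z)𝔤𝔥_{j7}(z) dz + o(α)`"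
(`P₂ = P^{0.5}T^{−10}` (2.21), so `log P₂ = 0.5 log P − 10𝓛^{1.1}`; the printed main term uses `0.5`).
Main order: `display818_diag` with `θ = 0.5`. Refines `Skeleton.Ded823`.
[cite: Zhang2022LandauSiegel, §8 p.49, tex L2509] -/
def Step8u052 : Prop :=
  ∀ ε : ℝ, 0 < ε → Skeleton.ForAllLarge fun D _ _ => ∀ j ∈ ({1, 2, 3} : Finset ℕ),
    ‖1 / (Real.log (Skeleton.P2 D) : ℂ) ^ 2 *
          (∫ x in (1 : ℝ)..Skeleton.P2 D,
            Skeleton.frakfW c' D j 7 x * Skeleton.frakgW c' D j 7 x / x) -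
        ((1 / (0.5 ^ 2 * Real.log (Skeleton.bigP D)) : ℝ) : ℂ) *
          ∫ z in (0 : ℝ)..0.5, ffP j 7 z * ghP j 7 z‖ ≤ ε * Skeleton.alpha D

/-- `Z22:§8.u053` CLAIM (p. 49, tex L2512), third display after (8.18): for `1 ≤ j ≤ 3`,
"`(log P₁ log P₂)⁻¹ ∫₁^{P₂} 𝔣_{j7}(x)𝔤_{j6}(P^{0.004}T^{10}x) dx/x
 = ((0.5)(0.504) log P)⁻¹ ∫₀^{0.5} 𝔣𝔣_{j7}(z)𝔤𝔥_{j6}(z + 0.004) dz + o(α)`" (`P₁/P₂ = P^{0.004}T^{10}`).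
Main order: `display818_cross₁` with `(θ₁, θ₂) = (0.504, 0.5)`. Refines `Skeleton.Ded823`.
[cite: Zhang2022LandauSiegel, §8 p.49, tex L2512] -/
def Step8u053 : Prop :=
  ∀ ε : ℝ, 0 < ε → Skeleton.ForAllLarge fun D _ _ => ∀ j ∈ ({1, 2, 3} : Finset ℕ),
    ‖1 / (Real.log (Skeleton.P1 D) * Real.log (Skeleton.P2 D) : ℂ) *
          (∫ x in (1 : ℝ)..Skeleton.P2 D,
            Skeleton.frakfW c' D j 7 x *
              Skeleton.frakgW c' D j 6 (Skeleton.bigP D ^ (0.004 : ℝ) * Skeleton.bigT D ^ 10 * x) / x) -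
        ((1 / (0.5 * 0.504 * Real.log (Skeleton.bigP D)) : ℝ) : ℂ) *
          ∫ z in (0 : ℝ)..0.5, ffP j 7 z * ghP j 6 (z + 0.004)‖ ≤ ε * Skeleton.alpha D

/-- `Z22:§8.u054` CLAIM (p. 49, tex L2517), fourth display after (8.18): for `1 ≤ j ≤ 3`,
"`(log P₁ log P₂)⁻¹ ∫₁^{P₂} 𝔣_{j6}(P^{0.004}T^{10}x)𝔤_{j7}(x) dx/x
 = ((0.5)(0.504) log P)⁻¹ ∫₀^{0.5} 𝔣𝔣_{j6}(z + 0.004)𝔤𝔥_{j7}(z) dz + o(α)`" (the source prints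
"`𝔤_{j7}(x))`" with a stray parenthesis, tex L2518). Main order: `display818_cross₂`. Refines
`Skeleton.Ded823`. [cite: Zhang2022LandauSiegel, §8 p.49, tex L2517] -/
def Step8u054 : Prop :=
  ∀ ε : ℝ, 0 < ε → Skeleton.ForAllLarge fun D _ _ => ∀ j ∈ ({1, 2, 3} : Finset ℕ),
    ‖1 / (Real.log (Skeleton.P1 D) * Real.log (Skeleton.P2 D) : ℂ) *
          (∫ x in (1 : ℝ)..Skeleton.P2 D,
            Skeleton.frakfW c' D j 6 (Skeleton.bigP D ^ (0.004 : ℝ) * Skeleton.bigT D ^ 10 * x) *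
              Skeleton.frakgW c' D j 7 x / x) -
        ((1 / (0.5 * 0.504 * Real.log (Skeleton.bigP D)) : ℝ) : ℂ) *
          ∫ z in (0 : ℝ)..0.5, ffP j 6 (z + 0.004) * ghP j 7 z‖ ≤ ε * Skeleton.alpha D

/-! ## "Inserting these into (8.13) we obtain" (p. 49, display before (8.19)) -/

/-- `Z22:§8.u055` CLAIM (p. 49, tex L2523): "Inserting these into (8.13) we obtain
`(2α)⁻¹S₁(𝐚₁₁,𝐚₂₁) + 2α⁻¹S₂(𝐚₁₁,𝐚₂₁) + (3/2)α⁻¹S₃(𝐚₁₁,𝐚₂₁) = 𝔞(b₁₁ + ι₂b₂₁ + ῑ₂b₁₂ + |ι₂|²b₂₂) + o(1)`"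
with the `b_{kl}` of (8.19)–(8.22) (banked `b11, b21, b12, b22`) and `ι₂` of (2.26) (banked `iota2`),
under (A). AMBIGUITY: printed "(8.13)"; the substitutions are inserted into **(8.12)** (tex L2472),
(8.13) being a definition — the typed claim is label-independent; deduced in the manuscript from
(8.12) (node `Z22:(8.12)`, slice L2-t8) and `Step8u049`–`Step8u054`. PROVED in the tree AT MAIN ORDER
(shifts at `β_j⁰`, `P₂ = P^{0.5}`, no `𝔞`/`o(·)`): `weighted_sum_S811_main`
(`Section8ChangeOfVariables`; the weights `1/2, 2, 3/2` and `α⁻¹` are Proposition 7.1's). Refines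
`Skeleton.Ded823`. [cite: Zhang2022LandauSiegel, §8 p.49, tex L2523] -/
def Step8u055 : Prop :=
  ∀ ε : ℝ, 0 < ε → Skeleton.ForAllLarge fun D _ χ => Skeleton.AssumptionA D χ →
    ‖(1 / (2 * (Skeleton.alpha D : ℂ)) * Skeleton.Sj c' D 1 (Skeleton.a11 χ) (Skeleton.a21 χ) +
          2 / (Skeleton.alpha D : ℂ) * Skeleton.Sj c' D 2 (Skeleton.a11 χ) (Skeleton.a21 χ) +
          3 / (2 * (Skeleton.alpha D : ℂ)) * Skeleton.Sj c' D 3 (Skeleton.a11 χ) (Skeleton.a21 χ)) -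
        (Skeleton.frakA χ : ℂ) *
          (b11 + iota2 * b21 + conj iota2 * b12 + (Complex.normSq iota2 : ℂ) * b22)‖ ≤ ε

end Claims

/-! ## (8.19)–(8.22): the integrals `b₁₁, b₂₂, b₂₁, b₁₂`, as identities about the banked `b11 … b12` -/

/-- `Z22:(8.19)` DEFINITION (p. 49, tex L2528; banked `b11`, `Section8Defs`):
"`b₁₁ = (0.504²π)⁻¹ ∫₀^{0.504} (½𝔣𝔣₁₆(z)𝔤𝔥₁₆(z) + 2𝔣𝔣₂₆(z)𝔤𝔥₂₆(z) + (3/2)𝔣𝔣₃₆(z)𝔤𝔥₃₆(z)) dz`" — recorded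
as the statement that the banked `b11` IS this printed integral (read on the page).
[cite: Zhang2022LandauSiegel, §8 (8.19) p.49, tex L2528] -/
def Eq819 : Prop := b11 = ((1 / (0.504 ^ 2 * π) : ℝ) : ℂ) *
  ∫ z in (0 : ℝ)..0.504, (1 / 2 * (ff16 z * gh16 z) + 2 * (ff26 z * gh26 z) + 3 / 2 * (ff36 z * gh36 z))

/-- `Z22:(8.20)` DEFINITION (p. 50, tex L2531; banked `b22`):
"`b₂₂ = (0.5²π)⁻¹ ∫₀^{0.5} (½𝔣𝔣₁₇(z)𝔤𝔥₁₇(z) + 2𝔣𝔣₂₇(z)𝔤𝔥₂₇(z) + (3/2)𝔣𝔣₃₇(z)𝔤𝔥₃₇(z)) dz`".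
[cite: Zhang2022LandauSiegel, §8 (8.20) p.50, tex L2531] -/
def Eq820 : Prop := b22 = ((1 / (0.5 ^ 2 * π) : ℝ) : ℂ) *
  ∫ z in (0 : ℝ)..0.5, (1 / 2 * (ff17 z * gh17 z) + 2 * (ff27 z * gh27 z) + 3 / 2 * (ff37 z * gh37 z))

/-- `Z22:(8.21)` DEFINITION (p. 50, tex L2534; banked `b21`):
"`b₂₁ = ((0.504)(0.5)π)⁻¹ ∫₀^{0.5} (½𝔣𝔣₁₇(z)𝔤𝔥₁₆(z+0.004) + 2𝔣𝔣₂₇(z)𝔤𝔥₂₆(z+0.004) + (3/2)𝔣𝔣₃₇(z)𝔤𝔥₃₆(z+0.004)) dz`".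
[cite: Zhang2022LandauSiegel, §8 (8.21) p.50, tex L2534] -/
def Eq821 : Prop := b21 = ((1 / (0.504 * 0.5 * π) : ℝ) : ℂ) *
  ∫ z in (0 : ℝ)..0.5, (1 / 2 * (ff17 z * gh16 (z + 0.004)) + 2 * (ff27 z * gh26 (z + 0.004))
    + 3 / 2 * (ff37 z * gh36 (z + 0.004)))

/-- `Z22:(8.22)` DEFINITION (p. 50, tex L2540; banked `b12`):
"`b₁₂ = ((0.504)(0.5)π)⁻¹ ∫₀^{0.5} (½𝔣𝔣₁₆(z+0.004)𝔤𝔥₁₇(z) + 2𝔣𝔣₂₆(z+0.004)𝔤𝔥₂₇(z) + (3/2)𝔣𝔣₃₆(z+0.004)𝔤𝔥₃₇(z)) dz`".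
[cite: Zhang2022LandauSiegel, §8 (8.22) p.50, tex L2540] -/
def Eq822 : Prop := b12 = ((1 / (0.504 * 0.5 * π) : ℝ) : ℂ) *
  ∫ z in (0 : ℝ)..0.5, (1 / 2 * (ff16 (z + 0.004) * gh17 z) + 2 * (ff26 (z + 0.004) * gh27 z)
    + 3 / 2 * (ff36 (z + 0.004) * gh37 z))

/-- (8.19) is the banked definition of `b11`. [cite: Zhang2022LandauSiegel, §8 (8.19) p.49] -/
theorem eq819_holds : Eq819 := rfl

/-- `Eq819` — `_holds` alias of `eq819_holds` above under the fact's exact name (appended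
2026-08-28, D-0026 bookkeeping: the proof term is the existing theorem of this file; no statement,
definition or attribute is edited; no new named fact; the ledger's debt table listed the fact
unproved). [cite: Zhang2022LandauSiegel, §8 (8.19) p.49] -/
theorem _root_.Literature.NumberTheory.LFunctions.Zhang2022.Section8dStatements.Eq819_holds :
    Eq819 :=
  _root_.Literature.NumberTheory.LFunctions.Zhang2022.Section8dStatements.eq819_holds
/-- (8.20) is the banked definition of `b22`. [cite: Zhang2022LandauSiegel, §8 (8.20) p.50] -/
theorem eq820_holds : Eq820 := rfl

/-- `Eq820` — `_holds` alias of `eq820_holds` above under the fact's exact name (appended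
2026-08-28, D-0026 bookkeeping: the proof term is the existing theorem of this file; no statement,
definition or attribute is edited; no new named fact; the ledger's debt table listed the fact
unproved). [cite: Zhang2022LandauSiegel, §8 (8.20) p.50] -/
theorem _root_.Literature.NumberTheory.LFunctions.Zhang2022.Section8dStatements.Eq820_holds :
    Eq820 :=
  _root_.Literature.NumberTheory.LFunctions.Zhang2022.Section8dStatements.eq820_holds
/-- (8.21) is the banked definition of `b21`. [cite: Zhang2022LandauSiegel, §8 (8.21) p.50] -/
theorem eq821_holds : Eq821 := rfl

/-- `Eq821` — `_holds` alias of `eq821_holds` above under the fact's exact name (appended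
2026-08-28, D-0026 bookkeeping: the proof term is the existing theorem of this file; no statement,
definition or attribute is edited; no new named fact; the ledger's debt table listed the fact
unproved). [cite: Zhang2022LandauSiegel, §8 (8.21) p.50] -/
theorem _root_.Literature.NumberTheory.LFunctions.Zhang2022.Section8dStatements.Eq821_holds :
    Eq821 :=
  _root_.Literature.NumberTheory.LFunctions.Zhang2022.Section8dStatements.eq821_holds
/-- (8.22) is the banked definition of `b12`. [cite: Zhang2022LandauSiegel, §8 (8.22) p.50] -/
theorem eq822_holds : Eq822 := rfl

/-- `Eq822` — `_holds` alias of `eq822_holds` above under the fact's exact name (appended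
2026-08-28, D-0026 bookkeeping: the proof term is the existing theorem of this file; no statement,
definition or attribute is edited; no new named fact; the ledger's debt table listed the fact
unproved). [cite: Zhang2022LandauSiegel, §8 (8.22) p.50] -/
theorem _root_.Literature.NumberTheory.LFunctions.Zhang2022.Section8dStatements.Eq822_holds :
    Eq822 :=
  _root_.Literature.NumberTheory.LFunctions.Zhang2022.Section8dStatements.eq822_holds

/-! ## `Θ₁(𝐚₁₁,𝐚₂₁)` "by Proposition 7.1", and (8.23) "by (8.7)" (p. 50) -/

section Claims

variable (c' : ℝ)

/-- `Z22:§8.u056` CLAIM (p. 50, tex L2546): "It follows by Proposition 7.1 that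
`Θ₁(𝐚₁₁,𝐚₂₁) = (b₁₁ + ι₂b₂₁ + ῑ₂b₁₂ + |ι₂|²b₂₂)𝔞𝔓 + o(𝔓)`" (under (A); `𝐚₁₁, 𝐚₂₁` of (8.8) =
`Skeleton.a11/a21`, `Θ₁` = `Skeleton.Theta1`, `𝔞` of (2.31) = `Skeleton.frakA`, `𝔓` of (2.9) =
`frakP`). The coefficient is the tree's `Theta1Coeff` (`Section8ChangeOfVariables`, definitionally).
Refines `Skeleton.Ded823` (the step from Prop. 7.1 + the display before (8.19); implicit in the
manuscript: the error term `E(𝐚₁₁,𝐚₂₁) = 𝔓𝓛²Σ_j|S_j|` of Prop. 7.1 is `o(𝔓)`).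
[cite: Zhang2022LandauSiegel, §8 p.50, tex L2546] -/
def Step8u056 : Prop :=
  ∀ ε : ℝ, 0 < ε → Skeleton.ForAllLarge fun D _ χ => Skeleton.AssumptionA D χ →
    ‖Skeleton.Theta1 c' χ (Skeleton.a11 χ) (Skeleton.a21 χ) -
        (b11 + iota2 * b21 + conj iota2 * b12 + (Complex.normSq iota2 : ℂ) * b22) *
          (Skeleton.frakA χ : ℂ) * (frakP D : ℂ)‖ ≤ ε * frakP D

/-- `Z22:§8.u056` DEDUCTION (p. 50, "It follows by Proposition 7.1 that"): the manuscript's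
inference `Step8u055 ∧ Prop. 7.1 ⇒ Step8u056`, as a named implication between nodes (refines the
coarse `Skeleton.Ded823 c′`; Prop. 7.1 = banked `Skeleton.Prop71 c′`). CLAIM (the implication itself
is the manuscript's; it silently uses `E(𝐚₁₁,𝐚₂₁) = o(𝔓)` and `𝐚₁₁, 𝐚₂₁` admissible (7.2), the latter
being the tree's `Skeleton.adm72_a11/adm72_a21`). [cite: Zhang2022LandauSiegel, §8 p.50, tex L2545] -/
def DedStep8u056 : Prop := Step8u055 c' → Skeleton.Prop71 c' → Step8u056 c'

/-- `Z22:(8.23)` DEDUCTION (p. 50, tex L2549, "This yields, by (8.7), (8.23)"): the manuscript's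
inference `(8.7) ∧ Step8u056 ⇒ (8.23)` between BANKED nodes `Skeleton.Eq87 c′` ("`Ξ₁₁ = 2Re Θ₁(𝐚₁₁,𝐚₂₁)
+ o(𝔓)`") and `Skeleton.Eval823 c′` ("`Ξ₁₁ = 𝔠₁𝔞𝔓 + o(𝔓)`", `𝔠₁` = banked `frakc1`), as a named
implication refining `Skeleton.Ded823 c′`; its content is `𝔠₁ = B + B̄` for the coefficient `B` of
`Step8u056` (tree: `frakc1_eq_coeff_add_conj`) — PROVED below (`dedEval823_holds`).
[cite: Zhang2022LandauSiegel, §8 (8.23) p.50, tex L2549] -/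
def DedEval823 : Prop := Skeleton.Eq87 c' → Step8u056 c' → Skeleton.Eval823 c'

end Claims

/-! ## `𝔠₁` and `c₁₁, c₂₂, c₁₂, c₂₁` (p. 50, displays after (8.23)) -/

/-- `Z22:§8.u057` DEFINITION (p. 50, tex L2554; banked `frakc1`, with `ι₂` = banked `iota2` of
(2.26) and `|ι₂|²` = `Complex.normSq ι₂`): "`𝔠₁ = c₁₁ + ι₂c₂₁ + ῑ₂c₁₂ + |ι₂|²c₂₂`".
[cite: Zhang2022LandauSiegel, §8 p.50, tex L2554] -/
def Step8u057 : Prop :=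
  frakc1 = c11 + iota2 * c21 + conj iota2 * c12 + (Complex.normSq iota2 : ℂ) * c22

/-- `Z22:§8.u058` DEFINITION (p. 50, tex L2558; banked `c11`): "`c₁₁ = b₁₁ + b̄₁₁`".
[cite: Zhang2022LandauSiegel, §8 p.50, tex L2558] -/
def Step8u058 : Prop := c11 = b11 + conj b11

/-- `Z22:§8.u059` DEFINITION (p. 50, tex L2561; banked `c22`): "`c₂₂ = b₂₂ + b̄₂₂`".
[cite: Zhang2022LandauSiegel, §8 p.50, tex L2561] -/
def Step8u059 : Prop := c22 = b22 + conj b22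

/-- `Z22:§8.u060` DEFINITION (p. 50, tex L2564; banked `c12`): "`c₁₂ = b₁₂ + b̄₂₁`" (NB the mixed
indices, as printed). [cite: Zhang2022LandauSiegel, §8 p.50, tex L2564] -/
def Step8u060 : Prop := c12 = b12 + conj b21

/-- `Z22:§8.u061` DEFINITION (p. 50, tex L2567; banked `c21`): "`c₂₁ = c̄₁₂`".
[cite: Zhang2022LandauSiegel, §8 p.50, tex L2567] -/
def Step8u061 : Prop := c21 = conj c12

/-- `𝔠₁` as printed is the banked `frakc1`. [cite: Zhang2022LandauSiegel, §8 p.50, tex L2554] -/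
theorem step8u057_holds : Step8u057 := rfl

/-- `Step8u057` — `_holds` alias of `step8u057_holds` above under the fact's exact name (appended
2026-08-28, D-0026 bookkeeping: the proof term is the existing theorem of this file; no statement,
definition or attribute is edited; no new named fact; the ledger's debt table listed the fact
unproved). [cite: Zhang2022LandauSiegel, §8 p.50, tex L2554] -/
theorem _root_.Literature.NumberTheory.LFunctions.Zhang2022.Section8dStatements.Step8u057_holds :
    Step8u057 :=
  _root_.Literature.NumberTheory.LFunctions.Zhang2022.Section8dStatements.step8u057_holds
/-- `c₁₁` as printed is the banked `c11`. [cite: Zhang2022LandauSiegel, §8 p.50, tex L2558] -/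
theorem step8u058_holds : Step8u058 := rfl

/-- `Step8u058` — `_holds` alias of `step8u058_holds` above under the fact's exact name (appended
2026-08-28, D-0026 bookkeeping: the proof term is the existing theorem of this file; no statement,
definition or attribute is edited; no new named fact; the ledger's debt table listed the fact
unproved). [cite: Zhang2022LandauSiegel, §8 p.50, tex L2558] -/
theorem _root_.Literature.NumberTheory.LFunctions.Zhang2022.Section8dStatements.Step8u058_holds :
    Step8u058 :=
  _root_.Literature.NumberTheory.LFunctions.Zhang2022.Section8dStatements.step8u058_holds
/-- `c₂₂` as printed is the banked `c22`. [cite: Zhang2022LandauSiegel, §8 p.50, tex L2561] -/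
theorem step8u059_holds : Step8u059 := rfl

/-- `Step8u059` — `_holds` alias of `step8u059_holds` above under the fact's exact name (appended
2026-08-28, D-0026 bookkeeping: the proof term is the existing theorem of this file; no statement,
definition or attribute is edited; no new named fact; the ledger's debt table listed the fact
unproved). [cite: Zhang2022LandauSiegel, §8 p.50, tex L2561] -/
theorem _root_.Literature.NumberTheory.LFunctions.Zhang2022.Section8dStatements.Step8u059_holds :
    Step8u059 :=
  _root_.Literature.NumberTheory.LFunctions.Zhang2022.Section8dStatements.step8u059_holds
/-- `c₁₂` as printed is the banked `c12`. [cite: Zhang2022LandauSiegel, §8 p.50, tex L2564] -/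
theorem step8u060_holds : Step8u060 := rfl

/-- `Step8u060` — `_holds` alias of `step8u060_holds` above under the fact's exact name (appended
2026-08-28, D-0026 bookkeeping: the proof term is the existing theorem of this file; no statement,
definition or attribute is edited; no new named fact; the ledger's debt table listed the fact
unproved). [cite: Zhang2022LandauSiegel, §8 p.50, tex L2564] -/
theorem _root_.Literature.NumberTheory.LFunctions.Zhang2022.Section8dStatements.Step8u060_holds :
    Step8u060 :=
  _root_.Literature.NumberTheory.LFunctions.Zhang2022.Section8dStatements.step8u060_holds
/-- `c₂₁` as printed is the banked `c21`. [cite: Zhang2022LandauSiegel, §8 p.50, tex L2567] -/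
theorem step8u061_holds : Step8u061 := rfl

/-- `Step8u061` — `_holds` alias of `step8u061_holds` above under the fact's exact name (appended
2026-08-28, D-0026 bookkeeping: the proof term is the existing theorem of this file; no statement,
definition or attribute is edited; no new named fact; the ledger's debt table listed the fact
unproved). [cite: Zhang2022LandauSiegel, §8 p.50, tex L2567] -/
theorem _root_.Literature.NumberTheory.LFunctions.Zhang2022.Section8dStatements.Step8u061_holds :
    Step8u061 :=
  _root_.Literature.NumberTheory.LFunctions.Zhang2022.Section8dStatements.step8u061_holds

/-! ## The printed numerical values (p. 50) — CLAIMS for the certified-numerics lane -/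

/-- `Z22:§8.u062` NUMERICAL CLAIM (p. 50, tex L2572): "Let `ε` be a complex number satisfying
`|ε| < 10⁻⁵`, not necessarily the same in each occurrence. Numerical calculation shows that
`c₁₁ = 3.61226 + ε/2`." Typed AS PRINTED, not asserted (the num lane certifies). Tree, for the record:
`c11_re_bounds` (`3.612261 < c₁₁ < 3.612262`), `c11_im` — consistent with the printed value.
[cite: Zhang2022LandauSiegel, §8 p.50, tex L2572] -/
def Step8u062_num : Prop := ∃ e : ℂ, ‖e‖ < 1e-5 ∧ c11 = 3.61226 + e / 2

/-- `Z22:§8.u063` NUMERICAL CLAIM (p. 50, tex L2575): "`c₂₂ = 1.32215 + ε/2`" (`|ε| < 10⁻⁵`). Typed AS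
PRINTED. Tree: `c22_re_bounds` (`1.322149 < c₂₂ < 1.32215`), `c22_im` — consistent.
[cite: Zhang2022LandauSiegel, §8 p.50, tex L2575] -/
def Step8u063_num : Prop := ∃ e : ℂ, ‖e‖ < 1e-5 ∧ c22 = 1.32215 + e / 2

/-- `Z22:§8.u064` NUMERICAL CLAIM (p. 50, tex L2578): "`c₁₂ = −0.45757 − 0.18179i + ε/√2`"
(`|ε| < 10⁻⁵`). Typed AS PRINTED, not asserted. Tree, for the record: `c12_re_bounds`
(`−0.457472 < Re c₁₂ < −0.457471`, printed `−0.45757`) and `c12_im_bounds`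
(`−0.201384 < Im c₁₂ < −0.201383`, printed `−0.18179`) — INCONSISTENT with the printed value; this is
the locus named by the cell's FINDINGS v3 (a prior, not a verdict of this file).
[cite: Zhang2022LandauSiegel, §8 p.50, tex L2578] -/
def Step8u064_num : Prop :=
  ∃ e : ℂ, ‖e‖ < 1e-5 ∧ c12 = -0.45757 - 0.18179 * I + e / (Real.sqrt 2 : ℂ)

/-! ## (8.24)

`Z22:(8.24)` (p. 50, tex L2581–L2583: "It follows that `𝔠₁ < 6.9955`. (8.24)") is the BANKED
`Ineq824` (`Section8Defs`, `@[claim … "disputed"]`), REFUTED in the tree as a statement about the true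
`𝔠₁` (`not_ineq824`, `frakc1_re_bounds`: `7.0501 < 𝔠₁ < 7.05011`), while the manuscript's inference
"It follows that" from the three printed values IS correct digit arithmetic
(`ineq824_of_printed_constants`: `6.99545 < 6.9955`). Nothing new is declared for this node: the
inference is deliberately NOT typed as an implication `Step8u062_num → Step8u063_num →
Step8u064_num → Ineq824`, because its third antecedent is refuted in the tree (`c12_im_bounds`) and the
implication would be vacuously provable (CONVENTIONS §4, vacuity). -/

/-! ## One kernel edge: (8.23) from (8.7) and `Step8u056` -/

/-- **The edge `(8.7) ∧ Step8u056 ⇒ (8.23)` holds** (pure bookkeeping: `Ξ₁₁ − 𝔠₁𝔞𝔓 =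
(Ξ₁₁ − 2Re Θ₁) + 2Re(Θ₁ − B𝔞𝔓)` with `𝔠₁ = B + B̄`, `frakc1_eq_coeff_add_conj`, and `|Re w| ≤ ‖w‖`).
[cite: Zhang2022LandauSiegel, §8 (8.23) p.50, tex L2549] -/
theorem dedEval823_holds (c' : ℝ) : DedEval823 c' := by
  intro h87 h56 ε hε
  have hε2 : 0 < ε / 2 := by positivity
  have hε4 : 0 < ε / 4 := by positivity
  refine ((h87 (ε / 2) hε2).and (h56 (ε / 4) hε4)).mono ?_
  intro D _ χ _ _ h hA
  obtain ⟨h1, h2⟩ := h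
  have e1 := h1 hA
  have e2 := h2 hA
  set Θ := Skeleton.Theta1 c' χ (Skeleton.a11 χ) (Skeleton.a21 χ)
  set B : ℂ := b11 + iota2 * b21 + conj iota2 * b12 + (Complex.normSq iota2 : ℂ) * b22 with hB
  have hc : frakc1.re = 2 * B.re := by
    have : frakc1 = Theta1Coeff + conj Theta1Coeff := frakc1_eq_coeff_add_conj
    rw [this, Complex.add_re, Complex.conj_re]
    simp only [hB, Theta1Coeff]
    ring
  have hre : (B * (Skeleton.frakA χ : ℂ) * (frakP D : ℂ)).re = B.re * Skeleton.frakA χ * frakP D := by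
    simp only [Complex.mul_re, Complex.ofReal_re, Complex.ofReal_im, mul_zero, sub_zero]
  have key : Skeleton.xi11 c' χ - frakc1.re * Skeleton.frakA χ * frakP D =
      (Skeleton.xi11 c' χ - 2 * Θ.re) + 2 * (Θ - B * (Skeleton.frakA χ : ℂ) * (frakP D : ℂ)).re := by
    rw [Complex.sub_re, hre, hc]; ring
  have h3 : |(Θ - B * (Skeleton.frakA χ : ℂ) * (frakP D : ℂ)).re| ≤
      ‖Θ - B * (Skeleton.frakA χ : ℂ) * (frakP D : ℂ)‖ := Complex.abs_re_le_norm _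
  rw [key]
  calc |Skeleton.xi11 c' χ - 2 * Θ.re + 2 * (Θ - B * (Skeleton.frakA χ : ℂ) * (frakP D : ℂ)).re|
      ≤ |Skeleton.xi11 c' χ - 2 * Θ.re| + |2 * (Θ - B * (Skeleton.frakA χ : ℂ) * (frakP D : ℂ)).re| :=
        abs_add_le _ _
    _ = |Skeleton.xi11 c' χ - 2 * Θ.re| + 2 * |(Θ - B * (Skeleton.frakA χ : ℂ) * (frakP D : ℂ)).re| := by
        rw [abs_mul, abs_two]
    _ ≤ ε / 2 * frakP D + 2 * (ε / 4 * frakP D) :=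
        add_le_add e1 (mul_le_mul_of_nonneg_left (h3.trans e2) (by norm_num))
    _ = ε * frakP D := by ring

variable (c' : ℝ) in
/-- `DedEval823` — `_holds` alias of `dedEval823_holds` above under the fact's exact name, stated under the
prover's own binders as section variables (appended 2026-08-28, D-0026 bookkeeping: the proof term is the
existing theorem of this file; no statement, definition or attribute is edited; no new named fact; the
ledger's debt table listed the fact unproved). [cite: Zhang2022LandauSiegel, §8 (8.23) p.50, tex L2549] -/
theorem _root_.Literature.NumberTheory.LFunctions.Zhang2022.Section8dStatements.DedEval823_holds :
    _root_.Literature.NumberTheory.LFunctions.Zhang2022.Section8dStatements.DedEval823 c' :=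
  _root_.Literature.NumberTheory.LFunctions.Zhang2022.Section8dStatements.dedEval823_holds (c' := c')

end Literature.NumberTheory.LFunctions.Zhang2022.Section8dStatements
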